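import Literature.AlgebraicGeometry.Frobenioids.Thm42SubAssemblyI
import Literature.AlgebraicGeometry.Frobenioids.Thm42PerfectionReduction
import Literature.AlgebraicGeometry.Frobenioids.PerfectionStandardTypes
import Literature.AlgebraicGeometry.Frobenioids.PerfectionLifting
import Literature.AlgebraicGeometry.Frobenioids.PerfFactorialPerfection
import HarnessLib

/-!
# Frobenioids I, Theorem 4.2 (i) AS TYPED (`PreFrobenioidData.Thm42i`) over bases of FSM-type, by passage to
# the perfections — modulo only "`C^pf` is a Frobenioid"

Mochizuki, *The geometry of Frobenioids I: the general theory*, Kyushu J. Math. **62** (2008)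
293–400, Thm. 4.2 (i), kurims text p. 77, proof p. 78 ll. 28–46 [cite: MochizukiFrdI2008, Thm. 4.2 (i) p.78]:
"since `Ψ` preserves non-group-like objects … and pull-back morphisms … we may assume … that the objects
under consideration are non-group-like. … Next, … to prove … that `Ψ` preserves primary steps and
Div-identity endomorphisms … it suffices to do so after passing to the perfections of the `C_i` [cf.
Theorem 3.4, (iii)]. Thus, … we may assume that both of the `C_i` are of perfect type."

PROOF-ONLY assembly (seat abc-iut-w4-d090, Thm. 4.2 closeout, L1-lead R81 (4); row `FrdI:Thm4.2/T42-L00`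
(i), general case). For Frobenioids `C_i → F_{Φ_i}` with `Φ_i` perf-factorial over bases of FSM-type, and
GIVEN that the perfections `C_i^pf → F_{Φ_i^pf}` (seat abc-iut-L1-d9's `Perfection.ops hF_i`) are
Frobenioids — the cell's standing named hypothesis `hPf_i : IsFrobenioid (Perfection.ops hF_i).toFunctor`
(cone node `FrdI:Prop3.2(iii)`, not dressed as a fact) — the typed `Thm42i` (seat abc-iut-L1-t3) HOLDS:

* `FrdI.T42.isFrobeniusCompatible_of_thm42Setting` — `Ψ` is compatible with arrows of Frobenius type
  (Thm. 3.4 (iii), seat abc-iut-L1-t13), so that `Ψ^pf := Perfection.map` (seat abc-iut-L1-d1) is defined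
  and is an equivalence (`map_isEquivalence`);
* `FrdI.T42.setting_perfection` — the `Setting` of the proof for `C₁^pf ⥲ C₂^pf`: perfect
  (`isOfPerfectType_perfection`, d1), isotropic / quasi-isotropic / non-dilating / group-like objects
  (`PerfectionStandardTypes`, seat abc-iut-w5-d042), perf-factorial (`PerfectionIsPerfFactorial_holds`,
  seat abc-iut-L1-d10 lineage), via `setting_of_perfectType_of_isOfFSMType`;
* `FrdI.T42.thm42i_of_isOfFSMType_of_perfection` — **Thm. 4.2 (i) as typed**: primary pre-steps and
  Div-identity endomorphisms for `Ψ^pf` (rows L07 / L11, L01 at the perfection), transported down along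
  `C_i → C_i^pf` (row L03: `perfectWLOG_of_equivalence`, seat abc-iut-w4-d068); steps (Thm. 3.4 (ii));
  (universally) Div-Frobenius-trivial objects by `isDivFrobeniusTrivial_map` /
  `isUniversallyDivFrobeniusTrivial_map` (seat abc-iut-L1-t14) with the C-level Thm. 3.4 (iii) transports.

No new definitions; no statement of the paper is strengthened.
-/

namespace Literature.AlgebraicGeometry.Frobenioids

namespace FrdI.T42

open CategoryTheory Opposite PreFrobenioidData PreFrobenioid.Perfection

universe w v v' u u'

variable {D₁ : Type u} [Category.{v} D₁] {Φ₁ : D₁ᵒᵖ ⥤ CommMonCat.{w}} {C₁ : Type u'} [Category.{v'} C₁]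
  {D₂ : Type u} [Category.{v} D₂] {Φ₂ : D₂ᵒᵖ ⥤ CommMonCat.{w}} {C₂ : Type u'} [Category.{v'} C₂]
  {F₁ : C₁ ⥤ ElemFrobenioid Φ₁} {F₂ : C₂ ⥤ ElemFrobenioid Φ₂} (Ψ : C₁ ≌ C₂)

/-! ### `Ψ` is compatible with arrows of Frobenius type (Thm. 3.4 (iii)) -/

/-- Under the hypotheses of Thm. 4.2 over bases of FSM-type (quasi-isotropic type, `Φ_i` non-dilating,
non-group-like objects on both sides), `Ψ` carries arrows of Frobenius type to arrows of Frobenius type of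
the same Frobenius degree (Thm. 3.4 (iii), seat abc-iut-L1-t13) — so `Ψ^pf : C₁^pf → C₂^pf` is defined.
[cite: MochizukiFrdI2008, Thm. 3.4 (iii) p.62] -/
theorem isFrobeniusCompatible_of_isOfFSMType (hF₁ : PreFrobenioid.IsFrobenioid F₁)
    (hF₂ : PreFrobenioid.IsFrobenioid F₂) (hq₁ : (ofFunctor Φ₁ F₁).IsOfQuasiIsotropicType)
    (hq₂ : (ofFunctor Φ₂ F₂).IsOfQuasiIsotropicType) (hnd₁ : IsNonDilatingOn Φ₁) (hnd₂ : IsNonDilatingOn Φ₂)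
    (hD₁ : IsOfFSMType D₁) (hD₂ : IsOfFSMType D₂) {N₁ : C₁} (hN₁ : ¬ PreFrobenioid.IsGroupLikeObj F₁ N₁)
    {N₂ : C₂} (hN₂ : ¬ PreFrobenioid.IsGroupLikeObj F₂ N₂) :
    PreFrobenioid.IsFrobeniusCompatible F₁ F₂ Ψ.functor :=
  { isFrobeniusType_map := fun _ _ _ h => FrdI.isFrobeniusType_map_quasiIsotropic hF₁ hF₂ hq₁ hq₂ hD₁ hD₂
      hnd₁ hnd₂ Ψ hN₁ hN₂ h
    degFr_map := fun _ _ f _ => FrdI.degFr_map hF₁ hF₂ hq₁ hq₂ hD₁ hD₂ hnd₁ hnd₂ Ψ hN₁ hN₂ f }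

/-! ### The setting of the proof for the perfections -/

/-- A Frobenioid of isotropic type is of Frobenius-isotropic type (take the identity as the arrow of
Frobenius type). [cite: MochizukiFrdI2008, Def. 1.2 (iv) p.23] -/
theorem isFrobeniusIsotropic_of_isOfIsotropicType (hF₁ : PreFrobenioid.IsFrobenioid F₁)
    (hi₁ : PreFrobenioid.IsOfIsotropicType F₁) : PreFrobenioid.IsOfType (PreFrobenioid.IsFrobeniusIsotropic F₁) :=
  fun A => ⟨A, 𝟙 A, PreFrobenioid.isFrobeniusType_of_isIso F₁ hF₁.isPreFrobenioid (𝟙 A), hi₁ A⟩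

/-- **The setting of the proof of Thm. 4.2 for the perfections `C₁^pf ⥲ C₂^pf`** (GIVEN that they are
Frobenioids): of perfect type (`isOfPerfectType_perfection`), isotropic and quasi-isotropic type with
`Φ_i^pf` non-dilating (seat abc-iut-w5-d042's `PerfectionStandardTypes`), `Φ_i^pf` perf-factorial
(`PerfectionIsPerfFactorial_holds`), with the non-group-like objects `(N_i, 1)`; hence all transports of
Thm. 3.4 (ii)/(iii) for `Ψ^pf` (`setting_of_perfectType_of_isOfFSMType`).
[cite: MochizukiFrdI2008, Thm. 4.2 (i) p.78] -/
theorem setting_perfection (hF₁ : PreFrobenioid.IsFrobenioid F₁) (hF₂ : PreFrobenioid.IsFrobenioid F₂)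
    (hPf₁ : PreFrobenioid.IsFrobenioid (ops hF₁).toFunctor)
    (hPf₂ : PreFrobenioid.IsFrobenioid (ops hF₂).toFunctor) (hi₁ : PreFrobenioid.IsOfIsotropicType F₁)
    (hi₂ : PreFrobenioid.IsOfIsotropicType F₂) (hpf₁ : Objectwise (fun M _ => IsPerfFactorial M) Φ₁)
    (hpf₂ : Objectwise (fun M _ => IsPerfFactorial M) Φ₂) (hnd₁ : (ofFunctor Φ₁ F₁).IsNonDilatingOn)
    (hnd₂ : (ofFunctor Φ₂ F₂).IsNonDilatingOn) (hD₁ : IsOfFSMType D₁) (hD₂ : IsOfFSMType D₂) {N₁ : C₁}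
    (hN₁ : ¬ PreFrobenioid.IsGroupLikeObj F₁ N₁) {N₂ : C₂} (hN₂ : ¬ PreFrobenioid.IsGroupLikeObj F₂ N₂)
    (hΨ : PreFrobenioid.IsFrobeniusCompatible F₁ F₂ Ψ.functor) :
    haveI := map_isEquivalence (hF₁ := hF₁) (hF₂ := hF₂) Ψ hΨ
    Setting (ops hF₁).toFunctor (ops hF₂).toFunctor (map (hF₁ := hF₁) (hF₂ := hF₂) hΨ).asEquivalence := by
  haveI := map_isEquivalence (hF₁ := hF₁) (hF₂ := hF₂) Ψ hΨ
  have hiso₁ := isFrobeniusIsotropic_of_isOfIsotropicType hF₁ hi₁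
  have hiso₂ := isFrobeniusIsotropic_of_isOfIsotropicType hF₂ hi₂
  refine setting_of_perfectType_of_isOfFSMType _ hPf₁ hPf₂
    ((ofFunctor_isOfPerfectType (ops hF₁).toFunctor).1 (isOfPerfectType_perfection hF₁ hiso₁))
    ((ofFunctor_isOfPerfectType (ops hF₂).toFunctor).1 (isOfPerfectType_perfection hF₂ hiso₂))
    (isOfIsotropicType_toFunctor hF₁ hiso₁) (isOfIsotropicType_toFunctor hF₂ hiso₂)
    (fun X => PerfectionIsPerfFactorial_holds (hpf₁ X)) (fun X => PerfectionIsPerfFactorial_holds (hpf₂ X))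
    (isOfQuasiIsotropicType_ops hF₁ hPf₁ hiso₁) (isOfQuasiIsotropicType_ops hF₂ hPf₂ hiso₂)
    (isNonDilatingOn_of_ofFunctor (F := (ops hF₁).toFunctor) (isNonDilatingOn_ops hF₁ hnd₁))
    (isNonDilatingOn_of_ofFunctor (F := (ops hF₂).toFunctor) (isNonDilatingOn_ops hF₂ hnd₂)) hD₁ hD₂
    ⟨(toPf hF₁).obj N₁, fun h => hN₁ ((isGroupLikeObj_ops_iff (hF := hF₁) _).1 h)⟩
    ⟨(toPf hF₂).obj N₂, fun h => hN₂ ((isGroupLikeObj_ops_iff (hF := hF₂) _).1 h)⟩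

/-! ### Theorem 4.2 (i) as typed, over FSM-type bases, modulo "`C^pf` is a Frobenioid" -/

set_option backward.isDefEq.respectTransparency false in
/-- **Theorem 4.2 (i) AS TYPED (`PreFrobenioidData.Thm42i`) for Frobenioids with perf-factorial divisor
monoids over bases of FSM-type, GIVEN that the perfections `C_i^pf` are Frobenioids** (`hPf_i`, cone node
Prop. 3.2 (iii)): under `Thm42Setting` (standard and isotropic type, not of group-like type) `Ψ` preserves
the steps that are primary pre-steps, Div-identity endomorphisms, Div-Frobenius-trivial objects and
universally Div-Frobenius-trivial objects — by passage to the perfections for the first two (rows L03,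
L07, L11) and Thm. 3.4 (ii)/(iii) at the level of `C_i` for the rest. [cite: MochizukiFrdI2008, Thm. 4.2 (i) p.77] -/
theorem thm42i_of_isOfFSMType_of_perfection (hF₁ : PreFrobenioid.IsFrobenioid F₁)
    (hF₂ : PreFrobenioid.IsFrobenioid F₂) (hPf₁ : PreFrobenioid.IsFrobenioid (ops hF₁).toFunctor)
    (hPf₂ : PreFrobenioid.IsFrobenioid (ops hF₂).toFunctor)
    (hpf₁ : Objectwise (fun M _ => IsPerfFactorial M) Φ₁) (hpf₂ : Objectwise (fun M _ => IsPerfFactorial M) Φ₂)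
    (hD₁ : IsOfFSMType D₁) (hD₂ : IsOfFSMType D₂) :
    (ofFunctor Φ₁ F₁).Thm42i (ofFunctor Φ₂ F₂) Ψ := by
  intro hT
  obtain ⟨⟨hs₁, hs₂⟩, ⟨hi₁', hi₂'⟩, ⟨hng₁, hng₂⟩⟩ := hT
  have hP₂ := hF₂.isPreFrobenioid
  have hi₁ : PreFrobenioid.IsOfIsotropicType F₁ := (ofFunctor_isOfIsotropicType F₁).1 hi₁'
  have hi₂ : PreFrobenioid.IsOfIsotropicType F₂ := (ofFunctor_isOfIsotropicType F₂).1 hi₂'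
  have hN₁ : ∃ A : C₁, ¬ PreFrobenioid.IsGroupLikeObj F₁ A := by
    by_contra h
    exact hng₁ ⟨fun A => (ofFunctor_isGroupLikeObj F₁ A).2 (not_exists_not.mp h A)⟩
  have hN₂ : ∃ A : C₂, ¬ PreFrobenioid.IsGroupLikeObj F₂ A := by
    by_contra h
    exact hng₂ ⟨fun A => (ofFunctor_isGroupLikeObj F₂ A).2 (not_exists_not.mp h A)⟩
  obtain ⟨N₁, hN₁⟩ := hN₁
  obtain ⟨N₂, hN₂⟩ := hN₂
  have hnd₁ := isNonDilatingOn_of_ofFunctor hs₁.nonDilating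
  have hnd₂ := isNonDilatingOn_of_ofFunctor hs₂.nonDilating
  -- Thm. 3.4 (iii) at the level of `C_i`
  have hfrob : ∀ ⦃X Y : C₁⦄ (φ : X ⟶ Y), PreFrobenioid.IsFrobeniusType F₁ φ →
      PreFrobenioid.IsFrobeniusType F₂ (Ψ.functor.map φ) := fun _ _ _ h =>
    FrdI.isFrobeniusType_map_quasiIsotropic hF₁ hF₂ hs₁.quasiIsotropic hs₂.quasiIsotropic hD₁ hD₂ hnd₁ hnd₂ Ψ
      hN₁ hN₂ h
  have hdeg : ∀ ⦃X Y : C₁⦄ (φ : X ⟶ Y),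
      PreFrobenioid.degFr F₂ (Ψ.functor.map φ) = PreFrobenioid.degFr F₁ φ := fun _ _ φ =>
    FrdI.degFr_map hF₁ hF₂ hs₁.quasiIsotropic hs₂.quasiIsotropic hD₁ hD₂ hnd₁ hnd₂ Ψ hN₁ hN₂ φ
  have hpb' : ∀ ⦃X Y : C₂⦄ (φ : X ⟶ Y), PreFrobenioid.IsPullbackMorphism F₂ φ →
      PreFrobenioid.IsPullbackMorphism F₁ (Ψ.inverse.map φ) := fun _ _ _ h =>
    FrdI.isPullbackMorphism_map_quasiIsotropic hF₂ hF₁ hs₂.quasiIsotropic hs₁.quasiIsotropic hD₂ hD₁ hnd₂ hnd₁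
      Ψ.symm hN₂ hN₁ h
  have hΨ : PreFrobenioid.IsFrobeniusCompatible F₁ F₂ Ψ.functor :=
    isFrobeniusCompatible_of_isOfFSMType Ψ hF₁ hF₂ hs₁.quasiIsotropic hs₂.quasiIsotropic hnd₁ hnd₂ hD₁ hD₂ hN₁ hN₂
  -- the setting for the perfections
  haveI := map_isEquivalence (hF₁ := hF₁) (hF₂ := hF₂) Ψ hΨ
  have S := setting_perfection Ψ hF₁ hF₂ hPf₁ hPf₂ hi₁ hi₂ hpf₁ hpf₂ hs₁.nonDilating hs₂.nonDilating hD₁ hD₂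
    hN₁ hN₂ hΨ
  have hndp₁ : IsNonDilatingOn (ops hF₁).monFunctor :=
    isNonDilatingOn_of_ofFunctor (F := (ops hF₁).toFunctor) (isNonDilatingOn_ops hF₁ hs₁.nonDilating)
  have hndp₂ : IsNonDilatingOn (ops hF₂).monFunctor :=
    isNonDilatingOn_of_ofFunctor (F := (ops hF₂).toFunctor) (isNonDilatingOn_ops hF₂ hs₂.nonDilating)
  -- rows L07 / L11 (+ L01) for `Ψ^pf`
  have hprim_pf : ∀ ⦃X Y : PreFrobenioid.Perfection hF₁⦄ (f : X ⟶ Y), (ops hF₁).IsPrimaryPreStep f →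
      (ops hF₂).IsPrimaryPreStep ((map (hF₁ := hF₁) (hF₂ := hF₂) hΨ).map f) :=
    fun _ _ _ h => S.isPrimaryPreStep_map h
  have hdiv_pf : ∀ ⦃X : PreFrobenioid.Perfection hF₁⦄ (f : X ⟶ X), (ops hF₁).IsDivIdentity f →
      (ops hF₂).IsDivIdentity ((map (hF₁ := hF₁) (hF₂ := hF₂) hΨ).map f) := by
    intro X f hf
    have hf' : PreFrobenioid.IsDivIdentity (ops hF₁).toFunctor f :=
      (ofFunctor_isDivIdentity (ops hF₁).toFunctor f).1 hf
    refine (ofFunctor_isDivIdentity (ops hF₂).toFunctor _).2 ?_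
    by_cases hX : PreFrobenioid.IsGroupLikeObj (ops hF₁).toFunctor X
    · exact PreFrobenioid.isDivIdentity_of_isGroupLikeObj (S.isGroupLikeObj_map hX) _
    · exact preservesDivIdentity_holds _ _ _ S hndp₁ hndp₂ (fun _ _ _ h => S.isPrimaryPreStep_map h)
        (fun _ _ _ h => S.isPrimaryPreStep_inverse_map h) X hX f hf'
  -- row L03: transport down to `C_i`
  obtain ⟨hP, hDI⟩ := perfectWLOG_of_equivalence hF₁ hF₂ Ψ hΨ
  have hprim := hP hprim_pf
  have hdivid := hDI hdiv_pf
  refine ⟨fun X Y φ hφ => ⟨PreFrobenioidData.isStep_map_of_isOfFSMType (Ψ := Ψ) hF₁ hF₂ hi₁ hi₂ hD₂ hφ.1,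
    hprim φ hφ.2⟩, fun A α hα => ?_, fun A hA => ?_, fun A hA => ?_⟩
  · -- Div-identity endomorphisms
    rw [ofFunctor_isDivIdentity F₁] at hα
    rw [ofFunctor_isDivIdentity F₂]
    exact hdivid α hα
  · -- Div-Frobenius-trivial objects
    rw [ofFunctor_isDivFrobeniusTrivial F₁] at hA
    rw [ofFunctor_isDivFrobeniusTrivial F₂]
    exact PreFrobenioid.isDivFrobeniusTrivial_map Ψ hfrob hdeg (fun α h => hdivid α h) hA
  · -- universally Div-Frobenius-trivial objects
    have hA' : PreFrobenioid.IsUniversallyDivFrobeniusTrivial F₁ A := fun A' φ hφ =>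
      (ofFunctor_isDivFrobeniusTrivial F₁ A').1 (hA φ ((ofFunctor_isPullbackMorphism F₁ φ).2 hφ))
    intro A₂ ψ hψ
    rw [ofFunctor_isDivFrobeniusTrivial F₂]
    exact PreFrobenioid.isUniversallyDivFrobeniusTrivial_map Ψ hP₂ hfrob hdeg hpb' (fun _ _ _ α h => hdivid α h)
      hA' ψ ((ofFunctor_isPullbackMorphism F₂ ψ).1 hψ)

end FrdI.T42

end Literature.AlgebraicGeometry.Frobenioids
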